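import Summits.Ventures.MM22.Rank333.Census22
import Summits.Ventures.MM22.Rank234.RealizeSound
import HarnessLib

/-!
# MM22 venture — the `hnone` producer for `Census22`: a REALIZABILITY-CHECK certificate refutes a census class

HONEST FRAMING (cell `pub-mm22`, seat p3 g5). Plumbing only, no new mathematics and no bound: engine-1 g9's
kernel-sound realizability checker (`Rank234/RealizeCheck` + `RealizeSound`, generic in the format, landed for the E3
theorem `rank234_eq_twenty`) concludes, from `node.check l m n K ph [] = true`, that no computation of `ψ_K` with `N`
products is REPRESENTED by a permutation of `ph` (`Realize.notRealizable_of_check`).  At `K = []` and the identity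
permutation this is exactly `¬ Census22.Realizable l m n N Q` — the per-class hypothesis `hnone` of
`Census22.rankGe22_of_legal_census` / `rankGe22_of_census_G`.  So the W5 kernel programme «≥ 22» has both producers
typed in the tree: class-list completeness (census replay) and per-class refutation (this file: one `RNode` literal +
one `decide` per HK7-legal class).  Nothing here asserts that any such certificate exists.
-/

namespace Summit.Ventures.MM22.Census22

open Summit.MatrixMultiplication.OmegaCensus.GF2RankLB
open Summit.Ventures.MM22.GF2Cert.Profile
open Summit.Ventures.MM22.GF2Cert.Realize
open Literature.Computability.AlgebraicComplexity

/-- **Generic adapter**: a passing realizability-check tree for the profile `Q` (as the list `List.ofFn Q`) at the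
root constraint `K = []` refutes `Realizable l m n N Q`, given `Cert l m n [] N` (every computation has `≥ N`
products, needed by the checker's tightness argument). -/
theorem not_realizable_of_check {l m n N : ℕ} (hN : Cert l m n [] N) (node : RNode (2 ^ (l * n)))
    (Q : Fin N → ℕ) (hc : node.check l m n [] (List.ofFn Q) [] = true) : ¬ Realizable l m n N Q :=
  fun ⟨β, hrep⟩ => notRealizable_of_check hN node hc β Q hrep (List.Perm.refl _)

/-- The same up to a permutation of the listed profile (the checker's native statement): if `List.ofFn Q` is a
permutation of the checked list `ph`, `Q` is unrealizable. -/
theorem not_realizable_of_check_perm {l m n N : ℕ} (hN : Cert l m n [] N) (node : RNode (2 ^ (l * n)))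
    {ph : List ℕ} (hc : node.check l m n [] ph [] = true) (Q : Fin N → ℕ) (hperm : (List.ofFn Q).Perm ph) :
    ¬ Realizable l m n N Q :=
  fun ⟨β, hrep⟩ => notRealizable_of_check hN node hc β Q hrep hperm

/-- **W5 instance (`⟨3,3,3⟩`, 21 products)**: a passing `RNode (2^9)` certificate for the class representative `Q`
gives `¬ Realizable21 Q` — the `hnone` entry for `Q` in `rankGe22_of_legal_census` (uses K2 via `cert21`). -/
theorem not_realizable21_of_check (node : RNode (2 ^ (3 * 3))) (Q : Fin 21 → ℕ)
    (hc : node.check 3 3 3 [] (List.ofFn Q) [] = true) : ¬ Realizable21 Q :=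
  not_realizable_of_check cert21 node Q hc

/-- `hnone` for a whole class list from one certificate per class (the shape a transcoder emits: the list of
representatives `L`, a certificate function `cert`, and ONE `decide`/per-class proof of `hchecks`). -/
theorem hnone_of_checks (L : List (Fin 21 → ℕ)) (cert : (Fin 21 → ℕ) → RNode (2 ^ (3 * 3)))
    (hchecks : ∀ Q ∈ L, (cert Q).check 3 3 3 [] (List.ofFn Q) [] = true) :
    ∀ Q ∈ L, ¬ Realizable21 Q :=
  fun Q hQ => not_realizable21_of_check (cert Q) Q (hchecks Q hQ)

end Summit.Ventures.MM22.Census22
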